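import Mathlib
import HarnessLib
import Literature.Barriers.ValiantsHypothesis.PartialDerivativesDetPerm
import Summits.ValiantsHypothesis.ValiantsHypothesis.Theorems.SummationBitsHomogeneousRung
import Summits.ValiantsHypothesis.ValiantsHypothesis.Theorems.SummationBitsRyserOptimalDepth3StubFlatteningRegime

/-!
# Crux `SummationBits.RyserOptimalDepth3` (stmt-ValiantsHypothesis-7565), line `registered` —
# what flattenings give for the heart stub `stub_esymHighDegree` (elementary-symmetric model)

Support file (lead prover, `--supports stmt-ValiantsHypothesis-7565`).  The heart stub H of the
line asks: for a representation `per_n = Σ_{i<r} a_i · e_n(m_i1, …, m_iD)` by elementary symmetric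
polynomials of degree `n` in `D` LINEAR forms, is `2^n ≤ r (D+1) (n+2)^c` once
`D > n + t⌊log₂(n+2)⌋`?  This file records exactly how far the method of partial derivatives
(Nisan–Wigderson) reaches in that model, so that the open part of H is delimited by theorems:

* `esym_choose_sq_le` — **the e-model flattening count**: for every `k`,
  `binom(n,k)² ≤ r · binom(D, n-k)`.  (The order-`k` partials of `e_n(m_1,…,m_D)` lie in the span
  of the `binom(D, n-k)` products `Π_{j∈T} m_j`, `#T = n-k` — `iterPDeriv_finset_prod_mem_span`,
  `iterPDeriv_aeval_esymm_mem_span`; those of `per_n` span `binom(n,k)²` dimensions —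
  `Literature.Barriers.ValiantsHypothesis.flatteningRank_perPoly`, PROVED in the tree.)
* `sq_le_mul` — the order `k = n-1`: `n² ≤ r · D`; for `r = 1` (Shpilka's homogeneous
  symmetric model) `per_n = a · e_n(m_1, …, m_D)` needs `D ≥ n²`, and no flattening says more.
* `four_pow_le` — the unconditional consequence at `k = ⌊n/2⌋`:
  `4^n ≤ (n+1)² · r · binom(D, ⌈n/2⌉)` for EVERY e-representation of `per_n` (all `D`).  At
  `D = n + s` this is `r ≥ 2^(n-s)/poly(n)`; for `D ≥ 3.5 n` (`n` large) this particular inequality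
  is void.  Other orders `k` in `esym_choose_sq_le` survive further (`k = n-1` gives `r · D ≥ n²`,
  non-void up to `D ≈ n²`), but no order gives `2^n/poly(n)` once `D ≥ n + ω(log n)` — the exact
  sense in which flattenings "stop at `D = n + O(log n)`".
* `esym_lowDegree` — **H's conclusion in the complementary (flattening) regime**: for every `t`
  some `c` (`= t+1`) with `2^n ≤ r (D+1) (n+2)^c` whenever `D ≤ n + t⌊log₂(n+2)⌋`.  Together with
  H this would give the bound for all `D`; H itself (the regime `D > n + t⌊log₂(n+2)⌋`) is open.

References: N. Nisan, A. Wigderson, *Lower bounds on arithmetic circuits via partial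
derivatives*, Comput. Complexity 6 (1996/97), §3; A. Shpilka, *Affine projections of symmetric
polynomials*, J. Comput. System Sci. 65 (2002) (the symmetric model `e_d(ℓ_1,…,ℓ_m)`).
-/

-- Sub = Summit layout; duplicated namespace component intended
set_option linter.dupNamespace false

namespace Summit.ValiantsHypothesis.ValiantsHypothesis.Theorems.SummationBitsRyserOptimalDepth3

open MvPolynomial
open Literature.Computability.AlgebraicComplexity
open Literature.Barriers.ValiantsHypothesis

namespace EsymFlattening

section Span

variable {K : Type*} [Field K] {σ : Type*} {ι : Type*} [DecidableEq ι]

/-- Every iterated partial derivative of order `#l` of a finite product `Π_{j∈A} ℓ_j` of affine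
forms lies in the span of the sub-products `Π_{j∈T} ℓ_j` with `#T = #A - #l`. [cite: NisanWigderson1996, §3] -/
theorem iterPDeriv_finset_prod_mem_span (ℓ : ι → MvPolynomial σ K)
    (hℓ : ∀ j, (ℓ j).totalDegree ≤ 1) (A : Finset ι) (l : List σ) :
    iterPDeriv l (∏ j ∈ A, ℓ j) ∈
      Submodule.span K (Set.range fun T : {T : Finset ι // T.card = A.card - l.length} =>
        ∏ j ∈ T.1, ℓ j) := by
  induction l with
  | nil => exact Submodule.subset_span ⟨⟨A, by simp⟩, rfl⟩
  | cons v l ih =>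
    rw [iterPDeriv_cons, List.length_cons, Nat.sub_add_eq]
    exact Summit.ValiantsHypothesis.SummationBits.pderiv_mem_span_of_mem_span ℓ hℓ v _ ih

/-- The order-`#l` partials of `e_n(m_1, …, m_D)` (`m_j` affine, in particular linear) lie in the
span of the `binom(D, n - #l)` sub-products `Π_{j∈T} m_j`, `#T = n - #l`. [cite: NisanWigderson1996, §3] -/
theorem iterPDeriv_aeval_esymm_mem_span {D : ℕ} (m : Fin D → MvPolynomial σ K)
    (hm : ∀ j, (m j).totalDegree ≤ 1) (n : ℕ) (l : List σ) :
    iterPDeriv l (aeval m (esymm (Fin D) K n)) ∈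
      Submodule.span K (Set.range fun T : {T : Finset (Fin D) // T.card = n - l.length} =>
        ∏ j ∈ T.1, m j) := by
  have hE : aeval m (esymm (Fin D) K n) =
      ∑ A ∈ Finset.powersetCard n Finset.univ, ∏ j ∈ A, m j := by
    simp only [esymm, map_sum, map_prod, aeval_X]
  rw [hE, iterPDeriv_sum]
  refine Submodule.sum_mem _ fun A hA => ?_
  have hcard : A.card = n := (Finset.mem_powersetCard.1 hA).2
  have hmem := iterPDeriv_finset_prod_mem_span m hm A l
  rw [hcard] at hmem
  exact hmem

end Span

/-- **The e-model flattening count.** If `per_n = Σ_{i<r} a_i · e_n(m_i1, …, m_iD)` with affine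
(e.g. linear) `m_ij`, then for every `k`: `binom(n,k)² ≤ r · binom(D, n-k)` — the order-`k`
partials of the right-hand side span at most `r · binom(D, n-k)` dimensions, those of `per_n`
exactly `binom(n,k)²` (`flatteningRank_perPoly`). [cite: NisanWigderson1996, §3] -/
theorem esym_choose_sq_le {n r D : ℕ} (k : ℕ) (a : Fin r → ℂ)
    (m : Fin r → Fin D → MvPolynomial (Fin n × Fin n) ℂ) (hm : ∀ i j, (m i j).totalDegree ≤ 1)
    (hsum : (∑ i, C (a i) * aeval (m i) (esymm (Fin D) ℂ n)) = perPoly (Fin n) ℂ) :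
    n.choose k * n.choose k ≤ r * D.choose (n - k) := by
  classical
  -- the `r · binom(D, n-k)` sub-products `Π_{j ∈ T} m_ij`, `#T = n - k`
  let b : Fin r × {T : Finset (Fin D) // T.card = n - k} → MvPolynomial (Fin n × Fin n) ℂ :=
    fun p => ∏ j ∈ p.2.1, m p.1 j
  have hle : Submodule.span ℂ (derivSet k (perPoly (Fin n) ℂ)) ≤
      Submodule.span ℂ (Set.range b) := by
    rw [Submodule.span_le]
    rintro _ ⟨l, hl, rfl⟩
    rw [← hsum, iterPDeriv_sum]
    refine Submodule.sum_mem _ fun i _ => ?_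
    rw [C_mul', iterPDeriv_smul]
    refine Submodule.smul_mem _ _ ?_
    have hmem := iterPDeriv_aeval_esymm_mem_span (m i) (hm i) n l
    refine Submodule.span_mono ?_ hmem
    rintro _ ⟨T, rfl⟩
    exact ⟨(i, ⟨T.1, by rw [T.2, hl]⟩), rfl⟩
  have hfin : Module.finrank ℂ (Submodule.span ℂ (derivSet k (perPoly (Fin n) ℂ))) =
      (n.choose k) ^ 2 := by
    rw [← shiftedPartialsRank_zero_eq ℂ k (perPoly (Fin n) ℂ), flatteningRank_perPoly ℂ n k]
  haveI : Module.Finite ℂ (Submodule.span ℂ (Set.range b)) :=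
    Module.Finite.span_of_finite ℂ (Set.finite_range b)
  have h1 : Module.finrank ℂ (Submodule.span ℂ (derivSet k (perPoly (Fin n) ℂ))) ≤
      Module.finrank ℂ (Submodule.span ℂ (Set.range b)) := Submodule.finrank_mono hle
  have h2 : Module.finrank ℂ (Submodule.span ℂ (Set.range b)) ≤
      Fintype.card (Fin r × {T : Finset (Fin D) // T.card = n - k}) := finrank_range_le_card b
  rw [Fintype.card_prod, Fintype.card_fin, Fintype.card_finset_len, Fintype.card_fin] at h2
  rw [← sq, ← hfin]
  exact h1.trans h2

/-- **What flattenings give for the heart, unconditionally**: every representation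
`per_n = Σ_{i<r} a_i · e_n(m_i1, …, m_iD)` by linear forms has
`4^n ≤ (n+1)² · r · binom(D, ⌈n/2⌉)` (all `n, r, D`).  At `D = n + s` this forces
`r ≥ 2^(n-s)/(n+1)²`; for `D ≥ 3.5·n` (`n` large) it is void. [cite: NisanWigderson1996, §3] -/
theorem four_pow_le {n r D : ℕ} (a : Fin r → ℂ) (m : Fin r → Fin D → MvPolynomial (Fin n × Fin n) ℂ)
    (hm : ∀ i j, (m i j).IsHomogeneous 1)
    (hsum : (∑ i, C (a i) * aeval (m i) (esymm (Fin D) ℂ n)) = perPoly (Fin n) ℂ) :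
    4 ^ n ≤ (n + 1) ^ 2 * r * D.choose (n - n / 2) := by
  have key := esym_choose_sq_le (n / 2) a m (fun i j => (hm i j).totalDegree_le) hsum
  have h2 := ChowBorderBound.FanInTwoRung.two_pow_le_succ_mul_choose_middle n
  calc 4 ^ n = 2 ^ n * 2 ^ n := by rw [← mul_pow]; norm_num
    _ ≤ ((n + 1) * n.choose (n / 2)) * ((n + 1) * n.choose (n / 2)) := Nat.mul_le_mul h2 h2
    _ = (n + 1) ^ 2 * (n.choose (n / 2) * n.choose (n / 2)) := by ring
    _ ≤ (n + 1) ^ 2 * (r * D.choose (n - n / 2)) := Nat.mul_le_mul_left _ key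
    _ = (n + 1) ^ 2 * r * D.choose (n - n / 2) := (mul_assoc _ _ _).symm

/-- **The `r = 1` rung, and the last surviving order**: at `k = n-1` the count reads
`n² ≤ r · D` — a single `e_n` of linear forms representing `per_n` needs `D ≥ n²` forms (the
order-`(n-1)` partials of `per_n` are all `n²` variables, those of `e_n(m)` lie in the span of the
`m_j`).  This is everything flattenings say about Shpilka's homogeneous symmetric model for
`per_n`. [cite: NisanWigderson1996, §3] -/
theorem sq_le_mul {n r D : ℕ} (a : Fin r → ℂ) (m : Fin r → Fin D → MvPolynomial (Fin n × Fin n) ℂ)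
    (hm : ∀ i j, (m i j).IsHomogeneous 1)
    (hsum : (∑ i, C (a i) * aeval (m i) (esymm (Fin D) ℂ n)) = perPoly (Fin n) ℂ) :
    n ^ 2 ≤ r * D := by
  have key := esym_choose_sq_le (n - 1) a m (fun i j => (hm i j).totalDegree_le) hsum
  rcases Nat.eq_zero_or_pos n with rfl | hn
  · simp
  · rw [Nat.choose_symm (show 1 ≤ n from hn), Nat.choose_one_right,
      show n - (n - 1) = 1 by omega, Nat.choose_one_right] at key
    simpa [sq] using key

open StubFlatteningRegime in
/-- **The heart's conclusion in the flattening regime** (the complement of the regime of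
`stub_esymHighDegree`): for every `t` there is `c` (`= t+1`) such that every representation
`per_n = Σ_{i<r} a_i · e_n(m_i1, …, m_iD)` by linear forms with `D ≤ n + t⌊log₂(n+2)⌋` has
`2^n ≤ r (D+1) (n+2)^c`.  (`binom(n,⌊n/2⌋)² ≤ r binom(D,⌈n/2⌉) ≤ r 2^(t⌊log₂(n+2)⌋) binom(n,⌊n/2⌋)`
and `2^n ≤ (n+1) binom(n,⌊n/2⌋)`.) [cite: NisanWigderson1996, §3] -/
theorem esym_lowDegree :
    ∀ t : ℕ, ∃ c : ℕ, ∀ n : ℕ, 1 ≤ n →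
      ∀ (r D : ℕ) (a : Fin r → ℂ) (m : Fin r → Fin D → MvPolynomial (Fin n × Fin n) ℂ),
        (∀ i j, (m i j).IsHomogeneous 1) →
          (∑ i, C (a i) * aeval (m i) (esymm (Fin D) ℂ n)) = perPoly (Fin n) ℂ →
            D ≤ n + t * Nat.log 2 (n + 2) → 2 ^ n ≤ r * (D + 1) * (n + 2) ^ c := by
  intro t
  refine ⟨t + 1, fun n _hn r D a m hm hsum hD => ?_⟩
  have key := esym_choose_sq_le (n / 2) a m (fun i j => (hm i j).totalDegree_le) hsum
  have hpos : 0 < n.choose (n / 2) := Nat.choose_pos (Nat.div_le_self n 2)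
  -- `binom(D, ⌈n/2⌉) ≤ 2^s binom(n, ⌊n/2⌋)`, `s = t⌊log₂(n+2)⌋`
  have hDc : D.choose (n - n / 2) ≤ 2 ^ (t * Nat.log 2 (n + 2)) * n.choose (n / 2) :=
    (Nat.choose_le_choose (n - n / 2) hD).trans (choose_add_le n _ (n - n / 2))
  have hr : n.choose (n / 2) ≤ r * 2 ^ (t * Nat.log 2 (n + 2)) := by
    refine Nat.le_of_mul_le_mul_right ?_ hpos
    calc n.choose (n / 2) * n.choose (n / 2) ≤ r * D.choose (n - n / 2) := key
      _ ≤ r * (2 ^ (t * Nat.log 2 (n + 2)) * n.choose (n / 2)) := Nat.mul_le_mul_left r hDc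
      _ = r * 2 ^ (t * Nat.log 2 (n + 2)) * n.choose (n / 2) := (mul_assoc _ _ _).symm
  calc 2 ^ n ≤ (n + 1) * n.choose (n / 2) :=
        ChowBorderBound.FanInTwoRung.two_pow_le_succ_mul_choose_middle n
    _ ≤ (n + 1) * (r * 2 ^ (t * Nat.log 2 (n + 2))) := Nat.mul_le_mul_left _ hr
    _ ≤ (n + 2) * (r * (n + 2) ^ t) :=
        Nat.mul_le_mul (Nat.le_succ _) (Nat.mul_le_mul_left r (two_pow_mul_log_le t n))
    _ = r * 1 * (n + 2) ^ (t + 1) := by ring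
    _ ≤ r * (D + 1) * (n + 2) ^ (t + 1) := by
        gcongr
        exact Nat.succ_le_succ (Nat.zero_le D)

end EsymFlattening

/-- **Registered sub-goal `stub_esymLowDegree` of crux stmt-ValiantsHypothesis-7565** (lead, line
`registered`): the heart's conclusion on the flattening regime `D ≤ n + t⌊log₂(n+2)⌋` of the
elementary-symmetric model — `EsymFlattening.esym_lowDegree` under its registered name.
[cite: NisanWigderson1996, §3] -/
theorem stub_esymLowDegree :
    ∀ t : ℕ, ∃ c : ℕ, ∀ n : ℕ, 1 ≤ n →
      ∀ (r D : ℕ) (a : Fin r → ℂ) (m : Fin r → Fin D → MvPolynomial (Fin n × Fin n) ℂ),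
        (∀ i j, (m i j).IsHomogeneous 1) →
          (∑ i, C (a i) * aeval (m i) (esymm (Fin D) ℂ n)) = perPoly (Fin n) ℂ →
            D ≤ n + t * Nat.log 2 (n + 2) → 2 ^ n ≤ r * (D + 1) * (n + 2) ^ c :=
  EsymFlattening.esym_lowDegree

end Summit.ValiantsHypothesis.ValiantsHypothesis.Theorems.SummationBitsRyserOptimalDepth3
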